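import Literature.AlgebraicGeometry.HodgeTheory.WeilTypeIIFibreOfPeriodSurjective
import Literature.AlgebraicGeometry.Motives.WeilTypeIIVeryGeneralMember
import HarnessLib

/-!
# A GENERIC type-II fibre in every period-surjective Weil family of odd half-rank:
# a fibre with endomorphism algebra EXACTLY the quaternion algebra `D_δ = K ⊕ Kψ`

Family `hodge`, layer `Literature/AlgebraicGeometry/HodgeTheory`; THEOREMS ONLY (no definition, no named fact, no
`sorry`; D-0026). Sequel to `HodgeTheory/WeilTypeIIFibreOfPeriodSurjective` (a [U]-period-surjective family of
abelian `2n`-folds, `n` odd, through a Weil-type member of discriminant class `[u]`, `u < 0`, has a fibre with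
quaternion multiplication `D_δ = K ⊕ Kψ = (-d, -u)_ℚ` BY ENDOMORPHISMS) and to `Motives/WeilTypeIIVeryGeneralMember`
(the type-II sub-domain `𝔖(j)` of the period domain of the rational Weil datum has a VERY GENERAL point: one whose
rational Hodge endomorphism algebra is EXACTLY `ℚ⟨α, j⟩`). Feeding [U] with that very general point instead of an
arbitrary point of `𝔖(j)` yields the GENERIC type-II fibre:

**(`exists_typeII_generic_endomorphism_of_periodSurjective`) under the same hypotheses, some fibre `Y_s` carries `ψ`
(`Ψ_s ψ = -ψ Ψ_s`, `ψ² = r²(-u)·𝟙 > 0`) such that EVERY endomorphism `φ` of `Y_s` acts on `H¹(Y_s; ℚ)` as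
`c₀ + c₁Ψ_s^* + c₂ψ^* + c₃Ψ_s^*ψ^*`, `cᵢ ∈ ℚ`** — by faithfulness of `φ ↦ φ^*|_{H¹}`
(`AbelianVariety.hom_eq_of_bettiCohomology_map_one_eq`) this says `End⁰(Y_s) = ℚ⟨Ψ_s, ψ⟩ = D_δ` exactly, i.e. `Y_s`
is the "generic member of the analytic family of type II" of [Shimura1963AnalyticFamilies, §4] realised as a fibre;
and (`exists_typeII_generic_fibre_of_periodConstructionAtWeilType`) the same inside Deligne's family through any
odd-`n` Weil-type `(P, ψ₀, h_K)` of class `[u]`, `u < 0`, MODULO the named fact J1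
(`deligne1982_weilFamily_periodConstructionAtWeilType`, whose clause (5U) is [U]).

MECHANISM (the extra step over the companion file). Let `J ∈ 𝔖(j₁)` be very general and `(Y_s, β)` the fibre over
`J` given by [U] (`β : H¹(P; ℚ) ≃ H¹(Y_s; ℚ)` `K`-linear, `β_ℂ V^{1,0}_J = H^{1,0}(Y_s)` by `h^{1,0} = 2n`). For
`φ ∈ End(Y_s)`, `φ^*` preserves `H^{1,0}(Y_s)` (pull-backs preserve Hodge types,
`IsOfHodgeType.map_of_isSmoothProjective`), so `g = β⁻¹φ^*β` preserves `V^{1,0}_J`, so `g_ℝ` commutes with `J`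
(`HodgeStructure.baseChange_comm_of_map_cxF1`), so `g ∈ End_Hdg(V, J) = ℚ⟨α, j₁⟩` (very general!), so
`φ^* = βgβ⁻¹ ∈ ℚ⟨βαβ⁻¹, βj₁β⁻¹⟩ = ℚ⟨Ψ_s^*, k⁻¹ψ^*⟩` (Riemann: `ψ^* = k·βj₁β⁻¹`).

HONEST REMARKS. [U] / J1 is a HYPOTHESIS (for Deligne's family `Γ∖B → Γ∖X⁺` it is the definition of the fibre; the
tree constructs no moduli space); nothing here proves a case of the Hodge conjecture; NOT addressed: simplicity of
`Y_s` (whether `D_δ` is a division algebra — for `(d, δ) = (3, [-2])`, `D₆ = (-3, 2)_ℚ`), the Néron–Severi or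
Mumford–Tate group of `Y_s`, Weil/Hodge classes of `Y_s`, positivity of the Rosati involution on `ψ`.

## References

* [Shimura1963AnalyticFamilies] G. Shimura, On analytic families of polarized abelian varieties and automorphic
  functions, Ann. of Math. 78 (1963) 149–192, §4 (Type II; the endomorphism algebra of the generic member is `D`).
* [vanGeemen1994HodgeAV] B. van Geemen, LNM 1594 (1994), 5.5–5.8 (5.7: "`J` commutes with the action of `K` ⟹
  `K ⊂ End(X)_ℚ`") and proof of Thm. 6.11 ("the general `J' ∈ Hₙ`").
* [Deligne1982HodgeCycles] P. Deligne (notes by J. S. Milne), LNM 900 (1982), §4, proof of Thm. 4.8 (Milne's TeXed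
  ed. pp. 32–34: the family `B → X⁺`, "the inverse image of `J ∈ X⁺` is `V(ℝ)` with the complex structure provided
  by `J`").
* [Lange2023AbelianVarietiesComplex] H. Lange, *Abelian Varieties over the Complex Numbers* (2023), Prop. 1.1.6,
  Thm. 2.1.13 (Riemann: `Hom(X, X') = Hom` of polarizable Hodge structures).
* [VoisinHodgeI2002] C. Voisin, Hodge Theory and Complex Algebraic Geometry I (2002), §7.1.1, §7.3.2 (pull-backs are
  morphisms of Hodge structures).
* [Landherr1936HermitianForms] W. Landherr, Abh. Math. Sem. Hamburg 11 (1936).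
-/

noncomputable section

open CategoryTheory AlgebraicGeometry Polynomial Module
open scoped TensorProduct
open Literature.AlgebraicTopology.SingularHomology
open Literature.AlgebraicGeometry Literature.AlgebraicGeometry.Motives
open Literature.AlgebraicGeometry.VanGeemen1994

namespace Literature.AlgebraicGeometry.Motives.HodgeStructure

universe u

variable {V : Type u} [AddCommGroup V] [Module ℚ V]

/-- A rational operator whose complexification preserves `V^{1,0} = cxF1 J` COMMUTES with the complex structure `J`
(converse of `baseChange_mem_cxF1`; `f_ℂ(a + iJa) = f_ℝ a + i f_ℝ Ja ∈ V^{1,0}` forces `f_ℝ Ja = J f_ℝ a`).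
[cite: vanGeemen1994HodgeAV, 5.7] -/
theorem baseChange_comm_of_map_cxF1 (J : ℝ ⊗[ℚ] V →ₗ[ℝ] ℝ ⊗[ℚ] V) (hJ : ∀ a, J (J a) = -a)
    (f : V →ₗ[ℚ] V) (h : ∀ x ∈ cxF1 J, f.baseChange ℂ x ∈ cxF1 J) (a : ℝ ⊗[ℚ] V) :
    f.baseChange ℝ (J a) = J (f.baseChange ℝ a) := by
  have hx := h _ (mkCx_mem_cxF1 J hJ a)
  rw [baseChange_mkCx, mem_cxF1_iff, imPart_mkCx, rePart_mkCx] at hx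
  exact hx.1

end Literature.AlgebraicGeometry.Motives.HodgeStructure

namespace Literature.AlgebraicGeometry.HodgeTheory

section HOne

variable {A : AbelianVariety ℂ}

/-- `ρ ∘ (φ^*_ℚ ⊗ 1) = φ^*_ℂ ∘ ρ` for the comparison `ρ : H¹(A; ℚ) ⊗ ℂ → H¹(A(ℂ); ℂ)` (private copy of the
naturality used in `HodgeTheory/RibetTypeOnePowersHodgeClasses`). [cite: VoisinHodgeI2002, §7.1.1] -/
private theorem ofRatClassBaseChange_baseChange_bettiMapHom' (φ : A ⟶ A)
    (x : ℂ ⊗[ℚ] bettiCohomology A.X 1) :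
    Motives.ofRatClassBaseChange (ComplexPoints A.X) 1
        ((bettiCohomology.map φ.hom.hom.hom 1).hom.baseChange ℂ x) =
      complexBetti.map φ.hom.hom.hom 1 (Motives.ofRatClassBaseChange (ComplexPoints A.X) 1 x) := by
  induction x using TensorProduct.induction_on with
  | zero => simp only [map_zero]
  | tmul c a =>
    rw [LinearMap.baseChange_tmul, Motives.ofRatClassBaseChange_tmul, Motives.ofRatClassBaseChange_tmul, map_smul]
    exact congrArg (c • ·) (ofRatClass_bettiMap φ.hom.hom.hom a)
  | add x y hx hy => simp only [map_add, hx, hy]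

end HOne

section TypeII

variable {n d : ℕ}

/-- **A GENERIC TYPE-II FIBRE IN EVERY PERIOD-SURJECTIVE WEIL FAMILY OF ODD HALF-RANK.** Same data as
`exists_typeII_endomorphism_of_periodSurjective` — an abelian `2n`-fold `(P, ψ₀, h_K)` of Weil type `(n, n)`, `n`
ODD, with a non-degenerate discriminant witness of class `[u]`, `u < 0`, and ANY family `(Y_s, Ψ_s)` of abelian
`2n`-folds satisfying [U] (period surjectivity, verbatim clause (5U) of
`deligne1982_weilFamily_periodConstructionAtWeilType`). THEN some fibre `Y_s` carries quaternion multiplication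
`ψ` (`Ψ_s ψ = -ψ Ψ_s`, `ψ² = c·𝟙`, `c = r²(-u) > 0`) AND IS GENERIC: **every endomorphism `φ` of `Y_s` acts on
`H¹(Y_s; ℚ)` as `c₀ + c₁Ψ_s^* + c₂ψ^* + c₃Ψ_s^*ψ^*` with `cᵢ ∈ ℚ`** — since `φ ↦ φ^*|_{H¹}` is injective
(`AbelianVariety.hom_eq_of_bettiCohomology_map_one_eq`), `End⁰(Y_s) = ℚ⟨Ψ_s, ψ⟩ = (-d, -u)_ℚ = D_{[u]}` EXACTLY:
the GENERIC member of the type-II locus as a fibre. Proof: as in the companion theorem, but the point `J` of the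
type-II sub-domain `𝔖(j₁)` fed to [U] is a VERY GENERAL one (`WeilDatum.exists_typeII_forall_mem_endAlg_iff` of
`Motives/WeilTypeIIVeryGeneralMember`: `End_Hdg(V, J) = ℚ + ℚα + ℚj₁ + ℚαj₁`); for `φ ∈ End(Y_s)` the transport
`β⁻¹φ^*β` preserves `V^{1,0}_J = β_ℂ⁻¹H^{1,0}(Y_s)` (pull-backs preserve Hodge types; `h^{1,0} = 2n` on both
sides), hence is a Hodge endomorphism of the very general member, hence lies in `ℚ⟨α, j₁⟩`; transporting back,
`βαβ⁻¹ = Ψ_s^*` and `βj₁β⁻¹ = k⁻¹ψ^*` (Riemann). [cite: Shimura1963AnalyticFamilies, §4 (Type II: endomorphism algebra of the generic member)]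
[cite: vanGeemen1994HodgeAV, 5.5–5.8 and proof of Thm. 6.11]
[cite: Deligne1982HodgeCycles, proof of Thm. 4.8 — the family B → X⁺ and «the inverse image of J ∈ X⁺ is V(ℝ) with the complex structure provided by J» (Milne's TeXed ed. p. 34)]
[cite: Lange2023AbelianVarietiesComplex, Prop. 1.1.6 and Thm. 2.1.13] [cite: Landherr1936HermitianForms] -/
theorem exists_typeII_generic_endomorphism_of_periodSurjective (hodd : Odd n)
    {P : AbelianVariety ℂ} (hP : P.dim = 2 * n) {ψ₀ : P ⟶ P}
    (e : ProjectiveEmbedding P.X) {a : complexBetti (projectiveSpace e.n ℂ) 2}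
    (ha : IsRationalClass a) (ha0 : a ≠ 0)
    (hweilP : ∃ c ∈ weilClassesOf P ψ₀ n d, c ≠ 0 ∧ IsOfHodgeType (2 * n) P.X (2 * n) n n c)
    (u : ℚˣ) (hu : (u : ℚ) < 0)
    (hδP : HasWeilDiscriminantNondeg P ψ₀ n d
      ((d : ℂ) • complexBetti.map e.ι 2 a + complexBetti.map ψ₀.hom.hom.hom 2 (complexBetti.map e.ι 2 a))
      (QuotientGroup.mk u))
    {S : Type*} (Y : S → AbelianVariety ℂ) (Ψ : ∀ s, Y s ⟶ Y s) (hY : ∀ s, (Y s).dim = 2 * n)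
    (hU : ∃ (m : ℕ) (hm : 1 ≤ m) (hPm : P.dim = m + 1) (hd : 0 < d) (hψ : ψ₀ ≫ ψ₀ = -(d • 𝟙 P))
        (ω : complexBetti P.X (2 + 2 * m)) (hω : IsRationalClass ω) (hω0 : ω ≠ 0),
        ∀ (J : (weilDatumOfKsymm hm hPm hd hψ e ha ha0 hω hω0).Cx →ₗ[ℂ]
            (weilDatumOfKsymm hm hPm hd hψ e ha ha0 hω hω0).Cx)
          (hW : Motives.IsWeilComplexStructure (weilDatumOfKsymm hm hPm hd hψ e ha ha0 hω hω0).hForm J),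
          ∃ (s : S) (β : bettiCohomology P.X 1 ≃ₗ[ℚ] bettiCohomology (Y s).X 1),
            (∀ x, β (bettiCohomology.map ψ₀.hom.hom.hom 1 x) =
              bettiCohomology.map (Ψ s).hom.hom.hom 1 (β x)) ∧
            ∀ x ∈ ((weilDatumOfKsymm hm hPm hd hψ e ha ha0 hω hω0).hodgeStructure J hW.sq).piece 1 0,
              IsOfHodgeType (2 * n) (Y s).X 1 1 0
                (Motives.ofRatClassBaseChange (ComplexPoints (Y s).X) 1 (β.toLinearMap.baseChange ℂ x))) :
    ∃ (s : S) (ψ : Y s ⟶ Y s) (c : ℕ), 0 < c ∧ Ψ s ≫ ψ = -(ψ ≫ Ψ s) ∧ ψ ≫ ψ = c • 𝟙 (Y s) ∧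
      (∃ r : ℚ, r ≠ 0 ∧ (c : ℚ) = r ^ 2 * (-(u : ℚ))) ∧
      ∀ φ : Y s ⟶ Y s, ∃ c₀ c₁ c₂ c₃ : ℚ, ∀ x : bettiCohomology (Y s).X 1,
        bettiCohomology.map φ.hom.hom.hom 1 x =
          c₀ • x + c₁ • bettiCohomology.map (Ψ s).hom.hom.hom 1 x +
            c₂ • bettiCohomology.map ψ.hom.hom.hom 1 x +
            c₃ • bettiCohomology.map (Ψ s).hom.hom.hom 1 (bettiCohomology.map ψ.hom.hom.hom 1 x) := by
  classical
  have hn : 1 ≤ n := hodd.pos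
  obtain ⟨m, hm, hPm, hd, hψ, ω, hω, hω0, hsurj⟩ := hU
  have hmn : m + 1 = 2 * n := by omega
  set DP := weilDatumOfKsymm hm hPm hd hψ e ha ha0 hω hω0 with hDP
  haveI : Module.Finite ℚ ↥(bettiCohomology P.X 1) := finite_bettiCohomology_one P
  have hVP : Module.finrank ℚ ↥(bettiCohomology P.X 1) = 4 * n := by
    rw [finrank_bettiCohomology_one, hP]; omega
  -- the field `K_d = ℚ(√-d)` acting through `√-d ↦ ψ₀^*`
  haveI : Fact (Irreducible (X ^ 2 + C (d : ℚ) : ℚ[X])) := ⟨irreducible_X_sq_add_C hd⟩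
  have hdQ : (0 : ℚ) < d := by exact_mod_cast hd
  have hα : weilSqrt d * weilSqrt d = algebraMap ℚ (weilField d) (-(d : ℚ)) :=
    weilSqrt_mul_self_eq_algebraMap d
  have hKspan : ∀ k : weilField d, ∃ p q : ℚ,
      k = algebraMap ℚ (weilField d) p + algebraMap ℚ (weilField d) q * weilSqrt d :=
    exists_eq_algebraMap_add_mul_weilSqrt d
  have hK2 : Module.finrank ℚ (weilField d) = 2 := Motives.finrank_rat_eq_two_of_sq_eq_neg hdQ hα hKspan
  obtain ⟨σ, hσα⟩ := exists_ringHom_weilSqrt_eq_neg d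
  have hσ : ∀ k : weilField d, k * σ k = algebraMap ℚ (weilField d) (Algebra.norm ℚ k) :=
    mul_conj_eq_algebraMap_norm hdQ hα hKspan σ hσα
  obtain ⟨instP, hinstP⟩ := exists_module_smul_eq hdQ hα hKspan DP.α DP.α_α
  letI : Module (weilField d) ↥(bettiCohomology P.X 1) := instP
  haveI : IsScalarTower ℚ (weilField d) ↥(bettiCohomology P.X 1) := hinstP.1
  have hαP : ∀ v, weilSqrt d • v = DP.α v := hinstP.2
  haveI : Module.Finite (weilField d) ↥(bettiCohomology P.X 1) :=
    Module.Finite.of_restrictScalars_finite ℚ (weilField d) _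
  have hVK : Module.finrank (weilField d) ↥(bettiCohomology P.X 1) = 2 * n := by
    have h := Module.finrank_mul_finrank ℚ (weilField d) ↥(bettiCohomology P.X 1)
    rw [hK2, hVP] at h
    omega
  have hWP : ∀ x y : ↥(bettiCohomology P.X 1),
      DP.E (weilSqrt d • x) (weilSqrt d • y) = (d : ℚ) * DP.E x y := fun x y => by
    rw [hαP, hαP]; exact DP.E_α x y
  -- the discriminant class of `D_P` is `[u]` (van Geemen 5.2 (3))
  obtain ⟨xP, ωP', amP, bmP, qP, hxP, hindP, hωP'r, hωP'0, hpairP, hdetP, hqP⟩ := hδP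
  have hdiscP := quotientMk_eq_weilDiscriminant_weilDatumOfKsymm hn hmn hPm hd hψ e ha ha0 hω hω0 DP hDP
    hαP xP ωP' amP bmP qP hxP hindP hωP'r hωP'0 hpairP hdetP
  have hdisc : weilDiscriminant DP.E (weilSqrt d) =
      (QuotientGroup.mk u : ℚˣ ⧸ normUnitsSubgroup ℚ (weilField d)) := by
    rw [← hdiscP]; exact hqP
  -- signature `(n, n)` (van Geemen 5.2 (4)), as `K`-subspaces
  obtain ⟨PP, NP, hPPα, hNPα, hPPn, hNPn, hPNP, hPPpos, hNPneg⟩ :=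
    exists_signature_submodules_weilDatumOfKsymm hn hmn hPm hd hψ e ha ha0 hω hω0 hweilP
  rw [← hDP] at hPPα hNPα hPPpos hNPneg
  obtain ⟨SP, hSP, hSPn⟩ := exists_submodule_of_smul_mem hKspan hK2 PP
    (fun x hx => by rw [hαP]; exact hPPα x hx) hPPn
  obtain ⟨SN, hSN, hSNn⟩ := exists_submodule_of_smul_mem hKspan hK2 NP
    (fun x hx => by rw [hαP]; exact hNPα x hx) hNPn
  have hinf : SP ⊓ SN = ⊥ := by
    rw [Submodule.eq_bot_iff]
    intro x hx
    have h : x ∈ PP ⊓ NP := ⟨(hSP x).1 hx.1, (hSN x).1 hx.2⟩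
    rwa [hPNP, Submodule.mem_bot] at h
  -- the type-II operator `j`, `j² = -u` (Landherr transport of the model)
  obtain ⟨j, hjα, hjj, hjE⟩ := exists_typeII_operator_of_weilDiscriminant_eq DP.E σ hdQ hα hσα hKspan hσ
    (fun x y => DP.E_swap y x) hWP hodd hVK
    ⟨SP, SN, hSPn, hSNn, hinf, fun x hx hx0 => by rw [hαP]; exact hPPpos x ((hSP x).1 hx) hx0,
      fun x hx hx0 => by rw [hαP]; exact hNPneg x ((hSN x).1 hx) hx0⟩ u hu hdisc
  have hjα' : ∀ x, j (DP.α x) = -(DP.α (j x)) := fun x => by rw [← hαP, ← hαP]; exact hjα x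
  -- clearing denominators: `j₁ = q • j`, `q = den(-u)`, `j₁² = q² (-u) = q · num(-u) ∈ ℕ`
  set b : ℚ := -(u : ℚ) with hb
  have hb0 : 0 < b := neg_pos.2 hu
  have hnum : 0 < b.num := Rat.num_pos.2 hb0
  obtain ⟨N, hNq, hNpos⟩ : ∃ N : ℕ, (N : ℚ) = (b.den : ℚ) * (b.den : ℚ) * b ∧ 0 < N := by
    refine ⟨b.den * b.num.toNat, ?_, Nat.mul_pos b.den_pos (by omega)⟩
    rw [Nat.cast_mul, mul_assoc, Rat.den_mul_eq_num]
    congr 1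
    have : ((b.num.toNat : ℤ) : ℚ) = (b.num : ℚ) := by rw [Int.toNat_of_nonneg hnum.le]
    exact_mod_cast this
  let j₁ : ↥(bettiCohomology P.X 1) →ₗ[ℚ] ↥(bettiCohomology P.X 1) := (b.den : ℚ) • j
  have hj₁ : ∀ x, j₁ x = (b.den : ℚ) • j x := fun _ => rfl
  have hj₁α : ∀ x, j₁ (DP.α x) = -(DP.α (j₁ x)) := fun x => by
    rw [hj₁, hj₁, hjα', map_smul, smul_neg]
  have hj₁j₁ : ∀ x, j₁ (j₁ x) = (N : ℚ) • x := fun x => by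
    rw [hj₁, hj₁, map_smul, hjj, smul_smul, smul_smul, hNq]
  have hj₁E : ∀ x y, DP.E (j₁ x) y = DP.E x (j₁ y) := fun x y => by
    rw [hj₁, hj₁, map_smul, LinearMap.smul_apply, map_smul, hjE]
  -- a point of the type-II sub-domain and the fibre over it ([U])
  -- a VERY GENERAL point of the type-II sub-domain (`Motives/WeilTypeIIVeryGeneralMember`): `End_Hdg = ℚ⟨α, j₁⟩`
  obtain ⟨J, hW, hcomm, hiff⟩ :=
    DP.exists_typeII_forall_mem_endAlg_iff j₁ hj₁α hj₁j₁ hj₁E (by exact_mod_cast hNpos)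
  have hpiece : ∀ x ∈ (DP.hodgeStructure J hW.sq).piece 1 0,
      j₁.baseChange ℂ x ∈ (DP.hodgeStructure J hW.sq).piece 1 0 :=
    fun x hx => DP.baseChange_mem_piece_one_zero_of_comm j₁ hW.sq hcomm hx
  obtain ⟨s, β, hβK, hβH⟩ := hsurj J hW
  -- the Hodge endomorphism `f = β j₁ β⁻¹` of `H¹(Y_s; ℚ)`
  let f : ↥(bettiCohomology (Y s).X 1) →ₗ[ℚ] ↥(bettiCohomology (Y s).X 1) :=
    β.toLinearMap ∘ₗ j₁ ∘ₗ β.symm.toLinearMap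
  have hf : ∀ x, f x = β (j₁ (β.symm x)) := fun _ => rfl
  haveI : Module.Finite ℚ ↥(bettiCohomology (Y s).X 1) := finite_bettiCohomology_one (Y s)
  haveI : Module.Finite ℂ (complexBetti (Y s).X 1) := finite_complexBetti_abelianVariety (Y s) 1
  have hXs : IsSmoothProjective (2 * n) (Y s).X := Motives.isSmoothProjective_of_dim_eq' (hY s)
  -- `β_ℂ V^{1,0}_J = H^{1,0}(Y_s)` by the dimension count `h^{1,0} = 2n`
  set ι := Motives.ofRatClassBaseChange (ComplexPoints (Y s).X) 1 with hι
  set M : Submodule ℂ (ℂ ⊗[ℚ] ↥(bettiCohomology (Y s).X 1)) :=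
    ((DP.hodgeStructure J hW.sq).piece 1 0).map (β.toLinearMap.baseChange ℂ) with hM
  set Nn : Submodule ℂ (ℂ ⊗[ℚ] ↥(bettiCohomology (Y s).X 1)) := (hodgeOneZero hXs).comap ι with hNn
  have hMN : M ≤ Nn := by
    rintro _ ⟨y, hy, rfl⟩
    exact hβH y hy
  have hβinj : Function.Injective (β.toLinearMap.baseChange ℂ) :=
    Function.LeftInverse.injective (HodgeStructure.symm_baseChange_baseChange (A := ℂ) β)
  have hfinM : Module.finrank ℂ M = 2 * n := by
    rw [hM, LinearEquiv.finrank_eq (Submodule.equivMapOfInjective _ hβinj _).symm,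
      WeilDatum.piece_one_zero_hodgeStructure]
    have h := HodgeStructure.two_mul_finrank_cxF1 (DP.realJ J) (DP.realJ_realJ J hW.sq)
    rw [hVP] at h
    omega
  have hfinN : Module.finrank ℂ Nn ≤ 2 * n := by
    have h1 : Module.finrank ℂ (Nn.map ι) ≤ Module.finrank ℂ (hodgeOneZero hXs) :=
      Submodule.finrank_mono (Submodule.map_comap_le ι _)
    rw [LinearEquiv.finrank_eq (Submodule.equivMapOfInjective _ (ofRatClassBaseChange_injective _ 1) _).symm,
      AbelianVariety.finrank_hodgeOneZero_eq_dim (Y s) hXs, hY s] at h1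
    exact h1
  have hMeq : M = Nn := Submodule.eq_of_le_of_finrank_le hMN (by rw [hfinM]; exact hfinN)
  have hHodge : ∀ x : ℂ ⊗[ℚ] ↥(bettiCohomology (Y s).X 1),
      IsOfHodgeType (Y s).dim (Y s).X 1 1 0 (Motives.ofRatClassBaseChange (ComplexPoints (Y s).X) 1 x) →
      IsOfHodgeType (Y s).dim (Y s).X 1 1 0
        (Motives.ofRatClassBaseChange (ComplexPoints (Y s).X) 1 (f.baseChange ℂ x)) := by
    intro x hx
    rw [hY s] at hx ⊢
    have hxN : x ∈ Nn := hx
    rw [← hMeq] at hxN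
    obtain ⟨y, hy, rfl⟩ := hxN
    have hfy : f.baseChange ℂ (β.toLinearMap.baseChange ℂ y) = β.toLinearMap.baseChange ℂ (j₁.baseChange ℂ y) := by
      change ((β.toLinearMap ∘ₗ j₁ ∘ₗ β.symm.toLinearMap).baseChange ℂ) (β.toLinearMap.baseChange ℂ y) = _
      rw [LinearMap.baseChange_comp, LinearMap.baseChange_comp, LinearMap.comp_apply, LinearMap.comp_apply,
        HodgeStructure.symm_baseChange_baseChange]
    rw [hfy]
    have hmem : β.toLinearMap.baseChange ℂ (j₁.baseChange ℂ y) ∈ Nn := by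
      rw [← hMeq]
      exact ⟨_, hpiece y hy, rfl⟩
    exact hmem
  -- Riemann: `u_Y^* = k · f` for an endomorphism `u_Y` of `Y_s`
  obtain ⟨uY, k, hk, huf⟩ := exists_hom_map_eq_nsmul_of_oneZero (Y s) (Y s) f hHodge
  refine ⟨s, uY, k ^ 2 * N, Nat.mul_pos (pow_pos hk 2) hNpos, ?_, ?_, ?_, ?_⟩
  · -- `Ψ_s ≫ u_Y = -(u_Y ≫ Ψ_s)` on `H¹(ℚ)`: `f` anticommutes with `Ψ_s^*` because `j₁` anticommutes with `ψ₀^*`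
    have hβK' : ∀ y, β.symm (bettiCohomology.map (Ψ s).hom.hom.hom 1 y) =
        bettiCohomology.map ψ₀.hom.hom.hom 1 (β.symm y) := fun y => by
      apply β.injective
      rw [LinearEquiv.apply_symm_apply, hβK, LinearEquiv.apply_symm_apply]
    have hj₁α' : ∀ x, j₁ (bettiCohomology.map ψ₀.hom.hom.hom 1 x) =
        -(bettiCohomology.map ψ₀.hom.hom.hom 1 (j₁ x)) := hj₁α
    have hfΨ : ∀ y, f (bettiCohomology.map (Ψ s).hom.hom.hom 1 y) =
        -(bettiCohomology.map (Ψ s).hom.hom.hom 1 (f y)) := fun y => by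
      rw [hf, hf, hβK', hj₁α', map_neg, hβK]
    apply AbelianVariety.hom_eq_of_bettiCohomology_map_one_eq
    ext y
    change bettiCohomology.map (Ψ s ≫ uY).hom.hom.hom 1 y = bettiCohomology.map (-(uY ≫ Ψ s)).hom.hom.hom 1 y
    rw [bettiMap_comp_apply, bettiMap_neg_apply, bettiMap_comp_apply, huf, huf, map_nsmul, hfΨ, smul_neg, neg_neg]
  · -- `u_Y ≫ u_Y = (k² N) • 𝟙` on `H¹(ℚ)`
    apply AbelianVariety.hom_eq_of_bettiCohomology_map_one_eq
    ext y
    change bettiCohomology.map (uY ≫ uY).hom.hom.hom 1 y = bettiCohomology.map ((k ^ 2 * N) • 𝟙 (Y s)).hom.hom.hom 1 y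
    rw [bettiMap_comp_apply, bettiMap_nsmul_id_apply, huf, huf, map_nsmul, hf, hf, LinearEquiv.symm_apply_apply,
      hj₁j₁, map_smul, LinearEquiv.apply_symm_apply, ← Nat.cast_smul_eq_nsmul ℚ, ← Nat.cast_smul_eq_nsmul ℚ,
      smul_smul, smul_smul]
    congr 1
    push_cast
    ring
  · -- `c = (k q)² (-u)`
    refine ⟨(k : ℚ) * b.den, mul_ne_zero (by exact_mod_cast hk.ne') (by exact_mod_cast b.den_pos.ne'), ?_⟩
    rw [Nat.cast_mul, Nat.cast_pow, hNq]
    ring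
  · -- GENERICITY: every endomorphism `φ` of `Y_s` acts on `H¹(Y_s; ℚ)` through `ℚ⟨Ψ_s^*, ψ^*⟩ = D_δ`
    intro φ
    let gY : ↥(bettiCohomology (Y s).X 1) →ₗ[ℚ] ↥(bettiCohomology (Y s).X 1) :=
      (bettiCohomology.map φ.hom.hom.hom 1).hom
    have hgY : ∀ x, gY x = bettiCohomology.map φ.hom.hom.hom 1 x := fun _ => rfl
    let g : ↥(bettiCohomology P.X 1) →ₗ[ℚ] ↥(bettiCohomology P.X 1) :=
      β.symm.toLinearMap ∘ₗ gY ∘ₗ β.toLinearMap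
    have hg : ∀ x, g x = β.symm (gY (β x)) := fun _ => rfl
    -- `φ^*` preserves `H^{1,0}(Y_s)` (pull-backs preserve Hodge types)
    have hgYN : ∀ x ∈ Nn, gY.baseChange ℂ x ∈ Nn := by
      intro x hx
      have hx' : IsOfHodgeType (2 * n) (Y s).X 1 1 0 (ι x) := hx
      have h := hx'.map_of_isSmoothProjective hXs hXs φ.hom.hom.hom
      rw [hι, ← ofRatClassBaseChange_baseChange_bettiMapHom'] at h
      exact h
    -- hence `g = β⁻¹ φ^* β` preserves `V^{1,0}_J` (`β_ℂ V^{1,0}_J = H^{1,0}(Y_s)`): a Hodge endomorphism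
    have hgpiece : ∀ y ∈ (DP.hodgeStructure J hW.sq).piece 1 0,
        g.baseChange ℂ y ∈ (DP.hodgeStructure J hW.sq).piece 1 0 := by
      intro y hy
      have hβy : β.toLinearMap.baseChange ℂ y ∈ Nn := by
        rw [← hMeq]
        exact ⟨y, hy, rfl⟩
      have h2 := hgYN _ hβy
      rw [← hMeq] at h2
      obtain ⟨y', hy', hy'eq⟩ := h2
      have hgy : g.baseChange ℂ y = y' := by
        change ((β.symm.toLinearMap ∘ₗ gY ∘ₗ β.toLinearMap).baseChange ℂ) y = y'
        rw [LinearMap.baseChange_comp, LinearMap.baseChange_comp, LinearMap.comp_apply, LinearMap.comp_apply,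
          ← hy'eq, HodgeStructure.symm_baseChange_baseChange]
      rw [hgy]
      exact hy'
    have hgEnd : g ∈ (DP.hodgeStructure J hW.sq).endAlg := by
      refine (DP.mem_endAlg_hodgeStructure_iff J hW.sq g).2
        (HodgeStructure.baseChange_comm_of_map_cxF1 (DP.realJ J) (DP.realJ_realJ J hW.sq) g fun x hx => ?_)
      rw [← DP.piece_one_zero_hodgeStructure J hW.sq] at hx ⊢
      exact hgpiece x hx
    -- very general: `g = c₀ + c₁ α + c₂ j₁ + c₃ α j₁`
    obtain ⟨c₀, c₁, c₂, c₃, hgc⟩ := (hiff g).1 hgEnd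
    have hkQ : (k : ℚ) ≠ 0 := by exact_mod_cast hk.ne'
    have hfx : ∀ x, f x = (k : ℚ)⁻¹ • bettiCohomology.map uY.hom.hom.hom 1 x := fun x => by
      rw [huf, ← Nat.cast_smul_eq_nsmul ℚ, smul_smul, inv_mul_cancel₀ hkQ, one_smul]
    have hβα : ∀ y, β (DP.α y) = bettiCohomology.map (Ψ s).hom.hom.hom 1 (β y) := fun y => hβK y
    refine ⟨c₀, c₁, c₂ * (k : ℚ)⁻¹, c₃ * (k : ℚ)⁻¹, fun x => ?_⟩
    have hgYx : bettiCohomology.map φ.hom.hom.hom 1 x = β (g (β.symm x)) := by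
      rw [hg, LinearEquiv.apply_symm_apply, LinearEquiv.apply_symm_apply, hgY]
    rw [hgYx, hgc]
    simp only [LinearMap.add_apply, LinearMap.smul_apply, Module.End.one_apply, Module.End.mul_apply, map_add,
      LinearEquiv.map_smul, LinearEquiv.apply_symm_apply]
    rw [hβα, hβα, LinearEquiv.apply_symm_apply, ← hf, hfx, map_smul, smul_smul, smul_smul]


/-- **A GENERIC TYPE-II FIBRE IN DELIGNE'S WEIL FAMILY, MODULO J1.** Granted Deligne's period construction
(`deligne1982_weilFamily_periodConstructionAtWeilType`, the NAMED FACT «J1», a HYPOTHESIS here): for every abelian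
`2n`-fold `(P, ψ₀, h_K)` OF WEIL TYPE `(n, n)`, `n` ODD, `d ≥ 1`, whose `K`-symmetrised hyperplane class has a
non-degenerate discriminant witness of class `[u]`, `u < 0`, Deligne's smooth projective family `f : 𝒳 → S` through
`P = 𝒳_{s₀}` has a fibre `Y_s` carrying `ψ` with `Ψ_s ψ = -ψ Ψ_s`, `ψ² = r²(-u)·𝟙 > 0` whose EVERY endomorphism acts on
`H¹(Y_s; ℚ)` through `ℚ⟨Ψ_s^*, ψ^*⟩`: `End⁰(Y_s) = (-d, -u)_ℚ = D_{[u]}` exactly — for sixfolds (`n = 3`) the GENERIC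
(type-II) member of every non-split cell of the right sign, modulo J1 (vhodge ROUTE-P3-g17 §3; the director's
"pointedness at a GENERIC simple type-II member", fibre-existence half). `exists_typeII_generic_endomorphism_of_periodSurjective`
fed with clause (5U) of the package. NOT here: simplicity of `Y_s` (whether `D_{[u]}` is a division algebra), its
Néron–Severi rank, anything on Weil or Hodge classes of `Y_s`.
[cite: Deligne1982HodgeCycles, §4 Prop. 4.4 and proof of Thm. 4.8 (Milne's TeXed ed. pp. 32–34)]
[cite: vanGeemen1994HodgeAV, 4.9, 5.3–5.8 and proof of Thm. 6.11] [cite: Shimura1963AnalyticFamilies, §4 (Type II)]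
[cite: Lange2023AbelianVarietiesComplex, Prop. 1.1.6 and Thm. 2.1.13] -/
theorem exists_typeII_generic_fibre_of_periodConstructionAtWeilType
    (hJ : deligne1982_weilFamily_periodConstructionAtWeilType) (hodd : Odd n) (hd : 1 ≤ d)
    {P : AbelianVariety ℂ} {ψ₀ : P ⟶ P} (hWT : IsWeilType P ψ₀ n d)
    (e : ProjectiveEmbedding P.X) {a : complexBetti (projectiveSpace e.n ℂ) 2}
    (ha : IsRationalClass a) (ha0 : a ≠ 0) (u : ℚˣ) (hu : (u : ℚ) < 0)
    (hδP : HasWeilDiscriminantNondeg P ψ₀ n d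
      ((d : ℂ) • complexBetti.map e.ι 2 a + complexBetti.map ψ₀.hom.hom.hom 2 (complexBetti.map e.ι 2 a))
      (QuotientGroup.mk u)) :
    ∃ (𝒳 S : SchemeOver ℂ) (f : 𝒳 ⟶ S) (g : 𝒳 ⟶ 𝒳) (s₀ : ComplexPoints S)
      (e' : P.X ≅ fiberOver f s₀)
      (Y : ComplexPoints S → AbelianVariety ℂ) (Ψ : ∀ s, Y s ⟶ Y s)
      (ε : ∀ s, (Y s).X ≅ fiberOver f s) (N : ℕ)
      (ι : 𝒳 ⟶ CategoryTheory.MonoidalCategoryStruct.tensorObj (projectiveSpace N ℂ) S)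
      (a' : complexBetti (projectiveSpace N ℂ) 2),
      IsSmoothProjectiveFamily f (2 * n) ∧
      AlgebraicGeometry.IsClosedImmersion ι.left ∧
      ι ≫ CategoryTheory.CartesianMonoidalCategory.snd (projectiveSpace N ℂ) S = f ∧
      IrreducibleSpace S.left ∧ AlgebraicGeometry.Smooth S.hom ∧ IsQuasiProjectiveOver S ∧
      g ≫ f = f ∧
      (e'.hom ≫ fiberι f s₀) ≫ g = ψ₀.hom.hom.hom ≫ (e'.hom ≫ fiberι f s₀) ∧
      (∀ s, (Y s).dim = 2 * n ∧ Ψ s ≫ Ψ s = -((d : ℤ) • 𝟙 (Y s)) ∧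
        ((ε s).hom ≫ fiberι f s) ≫ g = (Ψ s).hom.hom.hom ≫ ((ε s).hom ≫ fiberι f s)) ∧
      IsRationalClass a' ∧
      complexBetti.map e'.hom 2 (complexBetti.map (fiberι f s₀) 2
        (complexBetti.map
          (ι ≫ CategoryTheory.CartesianMonoidalCategory.fst (projectiveSpace N ℂ) S) 2 a')) =
        (d : ℂ) • complexBetti.map e.ι 2 a +
          complexBetti.map ψ₀.hom.hom.hom 2 (complexBetti.map e.ι 2 a) ∧
      ∃ (s : ComplexPoints S) (ψ : Y s ⟶ Y s) (c : ℕ), 0 < c ∧ Ψ s ≫ ψ = -(ψ ≫ Ψ s) ∧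
        ψ ≫ ψ = c • 𝟙 (Y s) ∧ (∃ r : ℚ, r ≠ 0 ∧ (c : ℚ) = r ^ 2 * (-(u : ℚ))) ∧
        ∀ φ : Y s ⟶ Y s, ∃ c₀ c₁ c₂ c₃ : ℚ, ∀ x : bettiCohomology (Y s).X 1,
          bettiCohomology.map φ.hom.hom.hom 1 x =
            c₀ • x + c₁ • bettiCohomology.map (Ψ s).hom.hom.hom 1 x +
              c₂ • bettiCohomology.map ψ.hom.hom.hom 1 x +
              c₃ • bettiCohomology.map (Ψ s).hom.hom.hom 1 (bettiCohomology.map ψ.hom.hom.hom 1 x) := by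
  have hn : 1 ≤ n := hodd.pos
  have hP : P.dim = 2 * n := hWT.dim_eq
  have hψZ : ψ₀ ≫ ψ₀ = -((d : ℤ) • 𝟙 P) := by rw [natCast_zsmul]; exact hWT.sq_eq
  -- a non-zero Weil class of type `(n, n)` (the Weil plane is a plane; van Geemen 4.10 / 5.2 (5)–(6))
  have hweilP : ∃ c ∈ weilClassesOf P ψ₀ n d, c ≠ 0 ∧ IsOfHodgeType (2 * n) P.X (2 * n) n n c := by
    have h2 := hWT.finrank_weilClassesOf
    have hne : weilClassesOf P ψ₀ n d ≠ ⊥ := by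
      intro h
      rw [h, finrank_bot] at h2
      exact two_ne_zero h2.symm
    obtain ⟨c, hc, hc0⟩ := (Submodule.ne_bot_iff _).1 hne
    exact ⟨c, hc, hc0, hWT.isOfHodgeType_of_mem_weilClassesOf hc⟩
  obtain ⟨𝒳, S, f, g, s₀, e', Y, Ψ, ε, N, ι, a', hfam, hιcl, hιf, hirr, hsm, hqp, hgf, hge', hY, -, hU, ha'r,
    ha'pol⟩ := hJ n d hn hd P ψ₀ e a hP hψZ ha ha0 hWT
  obtain ⟨s, ψ, c, hc, hanti, hsq, hr, hgen⟩ := exists_typeII_generic_endomorphism_of_periodSurjective hodd hP e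
    ha ha0 hweilP u hu hδP Y Ψ (fun s => (hY s).1) hU
  exact ⟨𝒳, S, f, g, s₀, e', Y, Ψ, ε, N, ι, a', hfam, hιcl, hιf, hirr, hsm, hqp, hgf, hge', hY, ha'r, ha'pol,
    s, ψ, c, hc, hanti, hsq, hr, hgen⟩

end TypeII

end Literature.AlgebraicGeometry.HodgeTheory

end
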